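import Summits.CriticalPhenomena.PercolationContinuityZ3.Theorems.PercNearOneGluingNoHeavyLowerTailAPLHubPathExcess
import HarnessLib

/-!
# `NoHeavyLowerTail` (stmt-CriticalPhenomena-4575) — BEYOND SERIES–PARALLEL II: the `K_{3,4}` excess in measure form
# (`prodBernoulli`), companion lower bounds to `gladkov3_all` and `sp_E_le_prodBernoulli`

Support file (prover prim-ineq-gen-8 gen 62; `--supports stmt-CriticalPhenomena-4575`; memo
run/shared/lean/prim/prim-ineq-gen-8/FINDING-gen62-BEYONDSP.md §1).  No definitions, no named facts, no sorries.

`…APLHubPathExcess` computes, at the `PrW` level, the three-point numbers of the core `K_{3,n}` (`n` hub paths in parallel) and certifies for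
`n = 4`, all weights `1/3`: three-point ratio `P(u,v ∈ cl g)²/(P(u ∈ cl g)P(v ∈ cl g)P(v ∈ cl u)) = 1.06027… > 1.06` and, with a pendant apex of
weight `10⁻⁴` at `g`, `E = κ²/(pπm) = 1.06021… > 1.06`.  This file transfers both to the product measure `μ = prodBernoulli w`
(`prodBernoulli_real_eq_PrW_univ`, `PrW_of_support`, weights `0` off the graph), in the vocabulary of the tree's universal upper bounds:
* `hubPaths_mem` — bookkeeping (the edges of `K n`).
* `hubPaths_threePoint_prodBernoulli`, **`exists_threePoint_ratio_gt`** — `∃` a finite weighted graph and `s, u, b` with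
  `(53/50)·μ(s↔u)μ(s↔b)μ(u↔b) < μ(s↔u ∩ s↔b)²`.  With `gladkov3_all` (`μ(s↔u ∩ s↔b)² ≤ 3·μ(s↔u)μ(s↔b)μ(u↔b)` on every finite weighted
  graph; published constant `8`, Gladkov arXiv:2408.08457 Thm 6.2, and `2` for planar graphs with the three points on one face) the optimal
  three-point constant lies in `(1.06, 3]`; inside two-terminal series–parallel graphs it is `28/27` (`sp_threePoint_le'`, sharp by the ladders).
* `hubPaths_E_prodBernoulli`, **`exists_E_gt_prodBernoulli`** — `∃` a finite weighted graph, apex `o`, ports `u, v` with `pπm > 0` and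
  `(53/50)·μ(o↔u)μ(o↔v)μ((o↔u)ᶜ ∩ u↔v) < (μ(o↔u ∩ o↔v) − μ(o↔u)μ(o↔v))²`, i.e. `E > 1.06`, against `E ≤ 28/27` on series–parallel apex
  networks (`sp_E_le_prodBernoulli`).
[this work]
-/

namespace Summit.CriticalPhenomena.PercolationContinuityZ3.Theorems

namespace APL

open Literature.Probability.Percolation Literature.Probability.Percolation.Gladkov Literature.Probability.Percolation.DecisionTree
open scoped Classical

variable {V : Type*} [Fintype V]

/-! ### Measure form (`prodBernoulli`): the companions of `gladkov3_all` (`≤ 3`) and `sp_E_le_prodBernoulli` (`≤ 28/27` on SP) -/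

section HubPathsMem

variable (x : ℕ → V) (g u v : V) (K : ℕ → Finset (Sym2 V))
  (hKs : ∀ r : ℕ, K (r + 1) = K r ∪ insert s(g, x r) ({s(x r, u)} ∪ {s(x r, v)}))

include hKs

omit [Fintype V] in
/-- The three edges of the `r`-th hub path belong to `K n` for `r < n`. [folklore] -/
theorem hubPaths_mem (n r : ℕ) (hr : r < n) : s(g, x r) ∈ K n ∧ s(x r, u) ∈ K n ∧ s(x r, v) ∈ K n := by
  induction n with
  | zero => omega
  | succ k ih =>
    rw [hKs k]
    by_cases hrk : r < k
    · obtain ⟨h1, h2, h3⟩ := ih hrk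
      exact ⟨Finset.mem_union_left _ h1, Finset.mem_union_left _ h2, Finset.mem_union_left _ h3⟩
    · obtain rfl : r = k := by omega
      exact ⟨Finset.mem_union_right _ (Finset.mem_insert_self _ _),
        Finset.mem_union_right _ (Finset.mem_insert_of_mem (Finset.mem_union_left _ (Finset.mem_singleton_self _))),
        Finset.mem_union_right _ (Finset.mem_insert_of_mem (Finset.mem_union_right _ (Finset.mem_singleton_self _)))⟩

end HubPathsMem

/-- **A three-point ratio above `1.06` (measure form, abstract vertex set).**  In every finite vertex set with seven distinct vertices
`z 1, …, z 7`, the bond percolation `μ = prodBernoulli w` with `w = 1/3` on the twelve pairs `{z 1, z 2, z 3} × {z 4, …, z 7}` (a `K_{3,4}`) and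
`w = 0` elsewhere satisfies `(53/50)·μ(z1↔z2)·μ(z1↔z3)·μ(z2↔z3) < μ(z1↔z2 ∩ z1↔z3)²`.  Companion lower bound to `gladkov3_all`
(`μ(s↔u ∩ s↔b)² ≤ 3·μ(s↔u)μ(s↔b)μ(u↔b)` on every finite weighted graph; Gladkov, arXiv:2408.08457, Thm 6.2: constant `8`, and `2` for planar
graphs with the three points on one face) and to `sp_threePoint_le'` (`≤ 28/27` inside two-terminal series–parallel graphs): the best constant
in the three-point inequality lies in `(1.06, 3]`. [this work] -/
theorem hubPaths_threePoint_prodBernoulli (W : Type*) [Fintype W] (z : ℕ → W) (hz : ∀ i j, i ≤ 7 → j ≤ 7 → z i = z j → i = j) :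
    ∃ w : Sym2 W → unitInterval,
      53 / 50 * ((Literature.Probability.LatticeModels.prodBernoulli w).real (openConn (z 1) (z 2) : Set (BondConfig W))
          * (Literature.Probability.LatticeModels.prodBernoulli w).real (openConn (z 1) (z 3) : Set (BondConfig W))
          * (Literature.Probability.LatticeModels.prodBernoulli w).real (openConn (z 2) (z 3) : Set (BondConfig W)))
        < (Literature.Probability.LatticeModels.prodBernoulli w).real
            ((openConn (z 1) (z 2) : Set (BondConfig W)) ∩ (openConn (z 1) (z 3) : Set (BondConfig W))) ^ 2 := by
  let x : ℕ → W := fun j => z (4 + j)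
  let K : ℕ → Finset (Sym2 W) := fun k =>
    Nat.rec (∅ : Finset (Sym2 W)) (fun r Kr => Kr ∪ insert s(z 1, x r) ({s(x r, z 2)} ∪ {s(x r, z 3)})) k
  have hK0 : K 0 = ∅ := rfl
  have hKs : ∀ r : ℕ, K (r + 1) = K r ∪ insert s(z 1, x r) ({s(x r, z 2)} ∪ {s(x r, z 3)}) := fun r => rfl
  let G : Finset (Sym2 W) := K 4
  let p : Sym2 W → ℝ := fun e => @ite ℝ (e ∈ G) (Classical.propDecidable _) (1 / 3) 0
  have hp01 : ∀ e, 0 ≤ p e ∧ p e ≤ 1 := fun e => by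
    simp only [p]
    split_ifs <;> norm_num
  let w : Sym2 W → unitInterval := fun e => ⟨p e, Set.mem_Icc.2 (hp01 e)⟩
  have hwp : (fun e => (w e : ℝ)) = p := rfl
  have hne : ∀ i j, i ≤ 7 → j ≤ 7 → i ≠ j → z i ≠ z j := fun i j hi hj hij h => hij (hz i j hi hj h)
  have hx : ∀ i j, i < 4 → j < 4 → x i = x j → i = j := fun i j hi hj hij => by
    have := hz (4 + i) (4 + j) (by omega) (by omega) hij
    omega
  have hxg : ∀ j, j < 4 → x j ≠ z 1 := fun j hj => hne (4 + j) 1 (by omega) (by omega) (by omega)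
  have hxu : ∀ j, j < 4 → x j ≠ z 2 := fun j hj => hne (4 + j) 2 (by omega) (by omega) (by omega)
  have hxv : ∀ j, j < 4 → x j ≠ z 3 := fun j hj => hne (4 + j) 3 (by omega) (by omega) (by omega)
  have hmem := hubPaths_mem x (z 1) (z 2) (z 3) K hKs 4
  have hh : ∀ r, r < 4 → p s(z 1, x r) = 1 / 3 := fun r hr => by simp only [p, G, if_pos (hmem r hr).1]
  have ha : ∀ r, r < 4 → p s(x r, z 2) = 1 / 3 := fun r hr => by simp only [p, G, if_pos (hmem r hr).2.1]
  have hb : ∀ r, r < 4 → p s(x r, z 3) = 1 / 3 := fun r hr => by simp only [p, G, if_pos (hmem r hr).2.2]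
  have key := hubPaths_threePoint_gt x (z 1) (z 2) (z 3) K hK0 hKs p (hne 1 2 (by omega) (by omega) (by omega))
    (hne 1 3 (by omega) (by omega) (by omega)) (hne 2 3 (by omega) (by omega) (by omega)) hx hxg hxu hxv hh ha hb
  -- transfer to the product measure
  have hcl : ∀ (T : Finset (Sym2 W)) (a b : W), (↑T : Set (Sym2 W)) ∈ openConn a b ↔ b ∈ cl T a :=
    fun T a b => by rw [mem_cl]; rfl
  have hsupp : ∀ X : Set (Finset (Sym2 W)), PrW Finset.univ (fun e => (w e : ℝ)) X = PrW G p X := fun X => by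
    rw [hwp]
    exact PrW_of_support p (Finset.subset_univ G) (fun e _ he => by simp only [p, if_neg he]) X
  have c12 : (Literature.Probability.LatticeModels.prodBernoulli w).real (openConn (z 1) (z 2) : Set (BondConfig W))
      = PrW G p {L : Finset (Sym2 W) | z 2 ∈ cl L (z 1)} := by
    rw [prodBernoulli_real_eq_PrW_univ w (X := {L : Finset (Sym2 W) | z 2 ∈ cl L (z 1)}) fun T => by
      simp only [Set.mem_setOf_eq, hcl], hsupp]
  have c13 : (Literature.Probability.LatticeModels.prodBernoulli w).real (openConn (z 1) (z 3) : Set (BondConfig W))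
      = PrW G p {L : Finset (Sym2 W) | z 3 ∈ cl L (z 1)} := by
    rw [prodBernoulli_real_eq_PrW_univ w (X := {L : Finset (Sym2 W) | z 3 ∈ cl L (z 1)}) fun T => by
      simp only [Set.mem_setOf_eq, hcl], hsupp]
  have c23 : (Literature.Probability.LatticeModels.prodBernoulli w).real (openConn (z 2) (z 3) : Set (BondConfig W))
      = PrW G p {L : Finset (Sym2 W) | z 3 ∈ cl L (z 2)} := by
    rw [prodBernoulli_real_eq_PrW_univ w (X := {L : Finset (Sym2 W) | z 3 ∈ cl L (z 2)}) fun T => by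
      simp only [Set.mem_setOf_eq, hcl], hsupp]
  have cτ : (Literature.Probability.LatticeModels.prodBernoulli w).real
      ((openConn (z 1) (z 2) : Set (BondConfig W)) ∩ (openConn (z 1) (z 3) : Set (BondConfig W)))
      = PrW G p {L : Finset (Sym2 W) | z 2 ∈ cl L (z 1) ∧ z 3 ∈ cl L (z 1)} := by
    rw [prodBernoulli_real_eq_PrW_univ w (X := {L : Finset (Sym2 W) | z 2 ∈ cl L (z 1) ∧ z 3 ∈ cl L (z 1)}) fun T => by
      simp only [Set.mem_setOf_eq, Set.mem_inter_iff, hcl], hsupp]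
  rw [show (106 : ℝ) / 100 = 53 / 50 by norm_num] at key
  refine ⟨w, ?_⟩
  rw [c12, c13, c23, cτ]
  exact key

/-- **`E > 1.06` beyond series–parallel (measure form, abstract vertex set).**  In every finite vertex set with eight distinct vertices
`z 0, …, z 7`, the bond percolation `μ = prodBernoulli w` with `w = 10⁻⁴` on the apex edge `z0 z1`, `w = 1/3` on `{z 1, z 2, z 3} × {z 4, …, z 7}`
and `w = 0` elsewhere has, for the apex `o = z 0` and the ports `u = z 2`, `v = z 3`:
`μ(o↔u)·μ(o↔v)·μ((o↔u)ᶜ ∩ u↔v) > 0` and `(53/50)·μ(o↔u)·μ(o↔v)·μ((o↔u)ᶜ ∩ u↔v) < (μ(o↔u ∩ o↔v) − μ(o↔u)μ(o↔v))²` — to be compared with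
`sp_E_le_prodBernoulli` (`≤ 28/27` whenever the `u–v` graph avoiding `o` is two-terminal series–parallel). [this work] -/
theorem hubPaths_E_prodBernoulli (W : Type*) [Fintype W] (z : ℕ → W) (hz : ∀ i j, i ≤ 7 → j ≤ 7 → z i = z j → i = j) :
    ∃ w : Sym2 W → unitInterval,
      0 < (Literature.Probability.LatticeModels.prodBernoulli w).real (openConn (z 0) (z 2) : Set (BondConfig W))
          * (Literature.Probability.LatticeModels.prodBernoulli w).real (openConn (z 0) (z 3) : Set (BondConfig W))
          * (Literature.Probability.LatticeModels.prodBernoulli w).real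
              ((openConn (z 0) (z 2) : Set (BondConfig W))ᶜ ∩ (openConn (z 2) (z 3) : Set (BondConfig W)))
      ∧ 53 / 50 * ((Literature.Probability.LatticeModels.prodBernoulli w).real (openConn (z 0) (z 2) : Set (BondConfig W))
          * (Literature.Probability.LatticeModels.prodBernoulli w).real (openConn (z 0) (z 3) : Set (BondConfig W))
          * (Literature.Probability.LatticeModels.prodBernoulli w).real
              ((openConn (z 0) (z 2) : Set (BondConfig W))ᶜ ∩ (openConn (z 2) (z 3) : Set (BondConfig W))))
        < ((Literature.Probability.LatticeModels.prodBernoulli w).real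
              ((openConn (z 0) (z 2) : Set (BondConfig W)) ∩ (openConn (z 0) (z 3) : Set (BondConfig W)))
            - (Literature.Probability.LatticeModels.prodBernoulli w).real (openConn (z 0) (z 2) : Set (BondConfig W))
              * (Literature.Probability.LatticeModels.prodBernoulli w).real (openConn (z 0) (z 3) : Set (BondConfig W))) ^ 2 := by
  let x : ℕ → W := fun j => z (4 + j)
  let K : ℕ → Finset (Sym2 W) := fun k =>
    Nat.rec (∅ : Finset (Sym2 W)) (fun r Kr => Kr ∪ insert s(z 1, x r) ({s(x r, z 2)} ∪ {s(x r, z 3)})) k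
  have hK0 : K 0 = ∅ := rfl
  have hKs : ∀ r : ℕ, K (r + 1) = K r ∪ insert s(z 1, x r) ({s(x r, z 2)} ∪ {s(x r, z 3)}) := fun r => rfl
  let G : Finset (Sym2 W) := insert s(z 0, z 1) (K 4)
  let p : Sym2 W → ℝ := fun e => if e ∈ G then (if z 0 ∈ e then 1 / 10000 else 1 / 3) else 0
  have hp01 : ∀ e, 0 ≤ p e ∧ p e ≤ 1 := fun e => by
    simp only [p]
    split_ifs <;> norm_num
  let w : Sym2 W → unitInterval := fun e => ⟨p e, Set.mem_Icc.2 (hp01 e)⟩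
  have hwp : (fun e => (w e : ℝ)) = p := rfl
  have hne : ∀ i j, i ≤ 7 → j ≤ 7 → i ≠ j → z i ≠ z j := fun i j hi hj hij h => hij (hz i j hi hj h)
  have hx : ∀ i j, i < 4 → j < 4 → x i = x j → i = j := fun i j hi hj hij => by
    have := hz (4 + i) (4 + j) (by omega) (by omega) hij
    omega
  have hxo : ∀ j, j < 4 → x j ≠ z 0 := fun j hj => hne (4 + j) 0 (by omega) (by omega) (by omega)
  have hxg : ∀ j, j < 4 → x j ≠ z 1 := fun j hj => hne (4 + j) 1 (by omega) (by omega) (by omega)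
  have hxu : ∀ j, j < 4 → x j ≠ z 2 := fun j hj => hne (4 + j) 2 (by omega) (by omega) (by omega)
  have hxv : ∀ j, j < 4 → x j ≠ z 3 := fun j hj => hne (4 + j) 3 (by omega) (by omega) (by omega)
  have hmem := hubPaths_mem x (z 1) (z 2) (z 3) K hKs 4
  have hzo : ∀ i j, i ≤ 7 → j ≤ 7 → i ≠ 0 → j ≠ 0 → z 0 ∉ s(z i, z j) := fun i j hi hj hi0 hj0 hmem' => by
    rcases Sym2.mem_iff.1 hmem' with h' | h'
    · exact hne 0 i (by omega) hi (by omega) h'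
    · exact hne 0 j (by omega) hj (by omega) h'
  have ho : p s(z 0, z 1) = 1 / 10000 := by
    simp only [p, G, if_pos (Finset.mem_insert_self _ _), if_pos (Sym2.mem_mk_left (z 0) (z 1))]
  have hh : ∀ r, r < 4 → p s(z 1, x r) = 1 / 3 := fun r hr => by
    simp only [p, G, if_pos (Finset.mem_insert_of_mem (hmem r hr).1)]
    exact if_neg (hzo 1 (4 + r) (by omega) (by omega) (by omega) (by omega))
  have ha : ∀ r, r < 4 → p s(x r, z 2) = 1 / 3 := fun r hr => by
    simp only [p, G, if_pos (Finset.mem_insert_of_mem (hmem r hr).2.1)]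
    exact if_neg (hzo (4 + r) 2 (by omega) (by omega) (by omega) (by omega))
  have hb : ∀ r, r < 4 → p s(x r, z 3) = 1 / 3 := fun r hr => by
    simp only [p, G, if_pos (Finset.mem_insert_of_mem (hmem r hr).2.2)]
    exact if_neg (hzo (4 + r) 3 (by omega) (by omega) (by omega) (by omega))
  obtain ⟨k1, k2⟩ := hubPaths_apex_excess x (z 1) (z 2) (z 3) K hK0 hKs p (z 0) (hne 0 1 (by omega) (by omega) (by omega))
    (hne 0 2 (by omega) (by omega) (by omega)) (hne 0 3 (by omega) (by omega) (by omega)) (hne 1 2 (by omega) (by omega) (by omega))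
    (hne 1 3 (by omega) (by omega) (by omega)) (hne 2 3 (by omega) (by omega) (by omega)) hx hxo hxg hxu hxv ho hh ha hb
  -- transfer to the product measure
  have hcl : ∀ (T : Finset (Sym2 W)) (a b : W), (↑T : Set (Sym2 W)) ∈ openConn a b ↔ b ∈ cl T a :=
    fun T a b => by rw [mem_cl]; rfl
  have hsupp : ∀ X : Set (Finset (Sym2 W)), PrW Finset.univ (fun e => (w e : ℝ)) X = PrW G p X := fun X => by
    rw [hwp]
    exact PrW_of_support p (Finset.subset_univ G) (fun e _ he => by simp only [p, if_neg he]) X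
  have cp : (Literature.Probability.LatticeModels.prodBernoulli w).real (openConn (z 0) (z 2) : Set (BondConfig W))
      = PrW G p {L : Finset (Sym2 W) | z 2 ∈ cl L (z 0)} := by
    rw [prodBernoulli_real_eq_PrW_univ w (X := {L : Finset (Sym2 W) | z 2 ∈ cl L (z 0)}) fun T => by
      simp only [Set.mem_setOf_eq, hcl], hsupp]
  have cπ : (Literature.Probability.LatticeModels.prodBernoulli w).real (openConn (z 0) (z 3) : Set (BondConfig W))
      = PrW G p {L : Finset (Sym2 W) | z 3 ∈ cl L (z 0)} := by
    rw [prodBernoulli_real_eq_PrW_univ w (X := {L : Finset (Sym2 W) | z 3 ∈ cl L (z 0)}) fun T => by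
      simp only [Set.mem_setOf_eq, hcl], hsupp]
  have cτ : (Literature.Probability.LatticeModels.prodBernoulli w).real
      ((openConn (z 0) (z 2) : Set (BondConfig W)) ∩ (openConn (z 0) (z 3) : Set (BondConfig W)))
      = PrW G p {L : Finset (Sym2 W) | z 2 ∈ cl L (z 0) ∧ z 3 ∈ cl L (z 0)} := by
    rw [prodBernoulli_real_eq_PrW_univ w (X := {L : Finset (Sym2 W) | z 2 ∈ cl L (z 0) ∧ z 3 ∈ cl L (z 0)}) fun T => by
      simp only [Set.mem_setOf_eq, Set.mem_inter_iff, hcl], hsupp]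
  have cm : (Literature.Probability.LatticeModels.prodBernoulli w).real
      ((openConn (z 0) (z 2) : Set (BondConfig W))ᶜ ∩ (openConn (z 2) (z 3) : Set (BondConfig W)))
      = PrW G p {L : Finset (Sym2 W) | z 2 ∉ cl L (z 0) ∧ z 3 ∈ cl L (z 2)} := by
    rw [prodBernoulli_real_eq_PrW_univ w (X := {L : Finset (Sym2 W) | z 2 ∉ cl L (z 0) ∧ z 3 ∈ cl L (z 2)}) fun T => by
      simp only [Set.mem_setOf_eq, Set.mem_inter_iff, Set.mem_compl_iff, hcl], hsupp]
  refine ⟨w, ?_, ?_⟩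
  · rw [cp, cπ, cm]; exact k1
  · rw [cp, cπ, cm, cτ]; exact k2

/-- **THE THREE-POINT CONSTANT EXCEEDS `1.06` (concrete measure form).**  There are `N`, weights `w : Sym2 (Fin N) → [0,1]` and three vertices
`s, u, b` with `(53/50)·μ(s↔u)·μ(s↔b)·μ(u↔b) < μ(s↔u ∩ s↔b)²` for `μ = prodBernoulli w` (`N = 8`; the `K_{3,4}` with weights `1/3`, exact
ratio `1.06027…`).  With `gladkov3_all`: the optimal constant `C₃` in `μ(s↔u ∩ s↔b)² ≤ C₃·μ(s↔u)μ(s↔b)μ(u↔b)` over all finite weighted graphs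
satisfies `1.06 < C₃ ≤ 3` (numerically `C₃ ≈ 1.18`, memo gen 56; `28/27` inside series–parallel graphs, `sp_threePoint_le'`). [this work] -/
theorem exists_threePoint_ratio_gt :
    ∃ (N : ℕ) (w : Sym2 (Fin N) → unitInterval) (s u b : Fin N),
      53 / 50 * ((Literature.Probability.LatticeModels.prodBernoulli w).real (openConn s u : Set (BondConfig (Fin N)))
          * (Literature.Probability.LatticeModels.prodBernoulli w).real (openConn s b : Set (BondConfig (Fin N)))
          * (Literature.Probability.LatticeModels.prodBernoulli w).real (openConn u b : Set (BondConfig (Fin N))))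
        < (Literature.Probability.LatticeModels.prodBernoulli w).real
            ((openConn s u : Set (BondConfig (Fin N))) ∩ (openConn s b : Set (BondConfig (Fin N)))) ^ 2 := by
  let z : ℕ → Fin 8 := fun j => if hj : j < 8 then ⟨j, hj⟩ else 0
  have hz : ∀ i j, i ≤ 7 → j ≤ 7 → z i = z j → i = j := fun i j hi hj hij => by
    simp only [z, dif_pos (show i < 8 by omega), dif_pos (show j < 8 by omega), Fin.mk.injEq] at hij
    exact hij
  obtain ⟨w, hw⟩ := hubPaths_threePoint_prodBernoulli (Fin 8) z hz
  exact ⟨8, w, z 1, z 2, z 3, hw⟩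

/-- **`E > 1.06 > 28/27` BEYOND SERIES–PARALLEL (concrete measure form).**  There are `N`, weights `w : Sym2 (Fin N) → [0,1]`, an apex `o`
and ports `u, v` with `μ(o↔u)μ(o↔v)μ((o↔u)ᶜ ∩ u↔v) > 0` and `(53/50)·μ(o↔u)μ(o↔v)μ((o↔u)ᶜ ∩ u↔v) < (μ(o↔u ∩ o↔v) − μ(o↔u)μ(o↔v))²` for
`μ = prodBernoulli w`, i.e. `E = κ²/(pπm) > 1.06`: the constant `28/27` of `sp_E_le_prodBernoulli` is a property of series–parallel
networks, not of percolation. [this work] -/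
theorem exists_E_gt_prodBernoulli :
    ∃ (N : ℕ) (w : Sym2 (Fin N) → unitInterval) (o u v : Fin N),
      0 < (Literature.Probability.LatticeModels.prodBernoulli w).real (openConn o u : Set (BondConfig (Fin N)))
          * (Literature.Probability.LatticeModels.prodBernoulli w).real (openConn o v : Set (BondConfig (Fin N)))
          * (Literature.Probability.LatticeModels.prodBernoulli w).real
              ((openConn o u : Set (BondConfig (Fin N)))ᶜ ∩ (openConn u v : Set (BondConfig (Fin N))))
      ∧ 53 / 50 * ((Literature.Probability.LatticeModels.prodBernoulli w).real (openConn o u : Set (BondConfig (Fin N)))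
          * (Literature.Probability.LatticeModels.prodBernoulli w).real (openConn o v : Set (BondConfig (Fin N)))
          * (Literature.Probability.LatticeModels.prodBernoulli w).real
              ((openConn o u : Set (BondConfig (Fin N)))ᶜ ∩ (openConn u v : Set (BondConfig (Fin N)))))
        < ((Literature.Probability.LatticeModels.prodBernoulli w).real
              ((openConn o u : Set (BondConfig (Fin N))) ∩ (openConn o v : Set (BondConfig (Fin N))))
            - (Literature.Probability.LatticeModels.prodBernoulli w).real (openConn o u : Set (BondConfig (Fin N)))
              * (Literature.Probability.LatticeModels.prodBernoulli w).real (openConn o v : Set (BondConfig (Fin N)))) ^ 2 := by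
  let z : ℕ → Fin 8 := fun j => if hj : j < 8 then ⟨j, hj⟩ else 0
  have hz : ∀ i j, i ≤ 7 → j ≤ 7 → z i = z j → i = j := fun i j hi hj hij => by
    simp only [z, dif_pos (show i < 8 by omega), dif_pos (show j < 8 by omega), Fin.mk.injEq] at hij
    exact hij
  obtain ⟨w, hw⟩ := hubPaths_E_prodBernoulli (Fin 8) z hz
  exact ⟨8, w, z 0, z 2, z 3, hw⟩

end APL

end Summit.CriticalPhenomena.PercolationContinuityZ3.Theorems
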